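import Summits.AnomalousDissipation.AnomalousDissipation.Theorems.SolenoidalFractalHomogenisationLagrangianStepFrameCouplingBricks
import Summits.AnomalousDissipation.AnomalousDissipation.Theorems.SolenoidalFractalHomogenisationLagrangianStepVmodSolenoidalClass
import HarnessLib

/-!
# K1L_D (stmt-AnomalousDissipation-27980), memo L24 (O1) at propagator level, ALL window times: constants are fixed by a v2 distorted
# propagator and by its ADJOINT (helper, `--supports 27980 --as helper`; prover lead-k1l-onelevel-p1 g7)

`IsDistortedPropagatorS.ae_inner_apply_const_eq` (`…FrameCouplingBricks`) gives `⟪U s t x, c⟫ = ⟪x, c⟫` for a.e. `t`; here it is upgraded to EVERY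
`t ∈ [s, Tw]` by weak continuity (`continuousOn`) — `inner_apply_const_eq` — and dualised: `(U s t)† c = c` in `V2` (`adjoint_apply_const_eq`:
the range of `(U s t)†` lies in the `G(s)`-solenoidal class because `U s t` kills its orthogonal complement, and `c` is in the class by Piola).
These are the two identities behind the J-cut at the mean (L24 (O1): `⟪v, J e⟫ = ⟪v, (J−1)e⟫`, `q*_T(J e) = q*_T((J−1)e)`).
No sorry, no definition, no named fact.  NOT a proof of any block, of `stub_Vmod_EHTthg`, of K1L_D or AD; rung F-D1.A0.
-/

set_option linter.dupNamespace false

noncomputable section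

namespace Summit.AnomalousDissipation.AnomalousDissipation.Theorems.SolenoidalFractalHomogenisation.LagrangianStep.CellClauseMod

open Literature.Analysis Literature.Analysis.FluidPDE Literature.Analysis.FunctionSpaces
open MeasureTheory Set Filter
open scoped ENNReal NNReal InnerProductSpace
open Summit.AnomalousDissipation.AnomalousDissipation.Theorems.SolenoidalFractalHomogenisation.LagrangianStep.VmodDist (solClass mem_solClass_iff)

/-- The `L²` class of a constant field. -/
def constV2 (c : EuclideanSpace ℝ (Fin 3)) : V2 := ((memLp_top_const c).mono_exponent le_top).toLp _

/-- Its representative is a.e. the constant. -/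
theorem coeFn_constV2 (c : EuclideanSpace ℝ (Fin 3)) : ((constV2 c : V2) : VF) =ᵐ[volume] fun _ => c :=
  ((memLp_top_const c).mono_exponent le_top).coeFn_toLp

/-- `⟪x, constV2 c⟫ = ∫ ⟪x y, c⟫`. -/
theorem inner_constV2 (x : V2) (c : EuclideanSpace ℝ (Fin 3)) : ⟪x, constV2 c⟫_ℝ = ∫ y, ⟪((x : V2) : VF) y, c⟫_ℝ := by
  rw [MeasureTheory.L2.inner_def]
  refine integral_congr_ae ?_
  filter_upwards [coeFn_constV2 c] with y hy
  rw [hy]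

/-- **Mean conservation at EVERY window time.**  For `0 ≤ s < Tw`, `x` `G(s)`-solenoidal and `t ∈ [s, Tw]`: `⟪U s t x, c⟫ = ⟪x, c⟫`. -/
theorem IsDistortedPropagatorS.inner_apply_const_eq {Tw θ nC : ℝ} {𝔸 : Torus.Visc4 (Fin 3)} {b : ℝ → VF}
    {G : ℝ → UnitAddTorus (Fin 3) → Matrix (Fin 3) (Fin 3) ℝ} {U : ℝ → ℝ → (V2 →L[ℝ] V2)}
    (hU : IsDistortedPropagatorS Tw 𝔸 b G U) (hG : IsFrameModulation θ Tw nC G) (hTw : 0 < Tw)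
    {s : ℝ} (hs0 : 0 ≤ s) (hsT : s < Tw) (x : V2) (hx : Torus.IsWeaklyDivFree (Torus.distort (G s) ((x : V2) : VF)))
    (c : EuclideanSpace ℝ (Fin 3)) {t : ℝ} (ht : t ∈ Icc s Tw) :
    ⟪U s t x, constV2 c⟫_ℝ = ⟪x, constV2 c⟫_ℝ := by
  -- a.e. in `τ = t − s`
  have hae := hU.ae_inner_apply_const_eq hG hTw hs0 hsT x hx c
  -- transport to a.e. in `t`
  have h1 : ∀ᵐ τ ∂(volume : Measure ℝ), τ ∈ Ioo 0 (Tw - s) → ⟪U s (s + τ) x, constV2 c⟫_ℝ = ∫ y, ⟪((x : V2) : VF) y, c⟫_ℝ :=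
    (ae_restrict_iff' measurableSet_Ioo).1 hae
  have hqmp : Measure.QuasiMeasurePreserving (fun t : ℝ => t - s) volume volume :=
    (measurePreserving_sub_right volume s).quasiMeasurePreserving
  have h2 : ∀ᵐ t ∂(volume : Measure ℝ), t ∈ Icc s Tw → ⟪U s t x, constV2 c⟫_ℝ = ∫ y, ⟪((x : V2) : VF) y, c⟫_ℝ := by
    have hs' : ∀ᵐ t ∂(volume : Measure ℝ), t ∉ ({s, Tw} : Set ℝ) :=
      (({s, Tw} : Set ℝ).toFinite.countable).ae_notMem _
    filter_upwards [hqmp.ae h1, hs'] with t ht hne htI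
    have htI' : t ∈ Ioo s Tw := by
      refine ⟨lt_of_le_of_ne htI.1 (fun h => hne ?_), lt_of_le_of_ne htI.2 (fun h => hne ?_)⟩
      · exact Or.inl h.symm
      · exact Or.inr h
    have h := ht ⟨by linarith [htI'.1], by linarith [htI'.2]⟩
    rwa [add_sub_cancel] at h
  have h3 : (fun t => ⟪U s t x, constV2 c⟫_ℝ) =ᵐ[volume.restrict (Icc s Tw)] fun _ => ∫ y, ⟪((x : V2) : VF) y, c⟫_ℝ :=
    (ae_restrict_iff' measurableSet_Icc).2 h2
  have hcont : ContinuousOn (fun t => ⟪U s t x, constV2 c⟫_ℝ) (Icc s Tw) := hU.continuousOn s hs0 hsT.le x (constV2 c)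
  have heq := Measure.eqOn_Icc_of_ae_eq (μ := (volume : Measure ℝ)) hsT.ne h3 hcont continuousOn_const ht
  simp only at heq
  rw [heq, inner_constV2]

/-- The constant class is `G(s)`-solenoidal for a frame modulation (Piola at every time). -/
theorem constV2_mem_solClass {θ Tw nC : ℝ} {G : ℝ → UnitAddTorus (Fin 3) → Matrix (Fin 3) (Fin 3) ℝ}
    (hG : IsFrameModulation θ Tw nC G) (hTw : 0 < Tw) (s : ℝ) (c : EuclideanSpace ℝ (Fin 3)) :
    constV2 c ∈ solClass (G s) := by
  have hGc : ∀ a c', Continuous fun y => G s y a c' := fun a c' => (hG.smooth_all hTw.le s a c').continuous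
  rw [mem_solClass_iff hGc]
  have hsm : ∀ i j, Torus.IsSmooth (fun y => G s y i j) := fun i j => hG.smooth_all hTw.le s i j
  have hdf : Torus.IsDivFree (Torus.distort (G s) (fun _ : UnitAddTorus (Fin 3) => c)) :=
    isDivFree_distort_const hsm (fun i => hG.piola_all hTw.le s i) c
  have hwk : Torus.IsWeaklyDivFree (Torus.distort (G s) (fun _ : UnitAddTorus (Fin 3) => c)) :=
    hdf.isWeaklyDivFree_holds (Torus.isSmooth_distort hsm (Torus.isSmooth_const c))
  refine hwk.congr_ae ?_
  filter_upwards [coeFn_constV2 c] with y hy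
  simp only [Torus.distort, hy]

/-- `x ∈ solClass (G s)` read as weak solenoidality (continuous frame entries). -/
theorem isWeaklyDivFree_of_mem_solClass {θ Tw nC : ℝ} {G : ℝ → UnitAddTorus (Fin 3) → Matrix (Fin 3) (Fin 3) ℝ}
    (hG : IsFrameModulation θ Tw nC G) (hTw : 0 < Tw) (s : ℝ) {x : V2} (hx : x ∈ solClass (G s)) :
    Torus.IsWeaklyDivFree (Torus.distort (G s) ((x : V2) : VF)) :=
  (mem_solClass_iff (fun a c' => (hG.smooth_all hTw.le s a c').continuous) x).1 hx

/-- The range of the ADJOINT window map lies in the `G(s)`-solenoidal class (the window map kills the orthogonal complement). -/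
theorem IsDistortedPropagator.adjoint_apply_mem_solClass {Tw θ nC : ℝ} {𝔸 : Torus.Visc4 (Fin 3)} {b : ℝ → VF}
    {G : ℝ → UnitAddTorus (Fin 3) → Matrix (Fin 3) (Fin 3) ℝ} {U : ℝ → ℝ → (V2 →L[ℝ] V2)}
    (hU : IsDistortedPropagator Tw 𝔸 b G U) (hG : IsFrameModulation θ Tw nC G) (hTw : 0 < Tw) (s t : ℝ) (ζ : V2) :
    ContinuousLinearMap.adjoint (U s t) ζ ∈ solClass (G s) := by
  haveI := VmodDist.hasOrthogonalProjection_solClass (G s)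
  rw [← Submodule.orthogonal_orthogonal (solClass (G s))]
  rw [Submodule.mem_orthogonal]
  intro y hy
  have hy0 : U s t y = 0 := hU.eq_zero_of_orth s t y fun z hz => by
    rw [real_inner_comm]
    exact (Submodule.mem_orthogonal _ y).1 hy z ((mem_solClass_iff (fun a c' => (hG.smooth_all hTw.le s a c').continuous) z).2 hz)
  rw [ContinuousLinearMap.adjoint_inner_right, hy0, inner_zero_left]

/-- **Constants are fixed by the ADJOINT window maps**: for `0 ≤ s < Tw`, `t ∈ [s, Tw]` and a constant field `c`, `(U s t)† c = c` in `V2`. -/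
theorem IsDistortedPropagatorS.adjoint_apply_const_eq {Tw θ nC : ℝ} {𝔸 : Torus.Visc4 (Fin 3)} {b : ℝ → VF}
    {G : ℝ → UnitAddTorus (Fin 3) → Matrix (Fin 3) (Fin 3) ℝ} {U : ℝ → ℝ → (V2 →L[ℝ] V2)}
    (hU : IsDistortedPropagatorS Tw 𝔸 b G U) (hG : IsFrameModulation θ Tw nC G) (hTw : 0 < Tw)
    {s : ℝ} (hs0 : 0 ≤ s) (hsT : s < Tw) (c : EuclideanSpace ℝ (Fin 3)) {t : ℝ} (ht : t ∈ Icc s Tw) :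
    ContinuousLinearMap.adjoint (U s t) (constV2 c) = constV2 c := by
  set v : V2 := ContinuousLinearMap.adjoint (U s t) (constV2 c) - constV2 c with hv
  have hvK : v ∈ solClass (G s) :=
    Submodule.sub_mem _ (hU.toIsDistortedPropagator.adjoint_apply_mem_solClass hG hTw s t _) (constV2_mem_solClass hG hTw s c)
  have hvorth : ∀ x ∈ solClass (G s), ⟪x, v⟫_ℝ = 0 := fun x hx => by
    rw [hv, inner_sub_right, ContinuousLinearMap.adjoint_inner_right,
      hU.inner_apply_const_eq hG hTw hs0 hsT x (isWeaklyDivFree_of_mem_solClass hG hTw s hx) c ht, sub_self]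
  have h0 : ⟪v, v⟫_ℝ = 0 := hvorth v hvK
  have hv0 : v = 0 := inner_self_eq_zero.1 h0
  rw [hv, sub_eq_zero] at hv0
  exact hv0

end Summit.AnomalousDissipation.AnomalousDissipation.Theorems.SolenoidalFractalHomogenisation.LagrangianStep.CellClauseMod

end
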